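import Mathlib
import Summits.BirchSwinnertonDyer.BirchSwinnertonDyer.Theorems.Rank2ObservatoryThreeIsoClassBound
import Summits.BirchSwinnertonDyer.BirchSwinnertonDyer.Theorems.Rank2ObservatoryThreeIsoIntegral
import Summits.BirchSwinnertonDyer.BirchSwinnertonDyer.Theorems.Rank2ObservatoryThreeIsoNormCut
import Summits.BirchSwinnertonDyer.BirchSwinnertonDyer.Theorems.Rank2ObservatoryThreeIsoPrimes

/-!
# BirchSwinnertonDyer — rank ≥ 2 observatory, KERNEL-3ISO (B3b-3): the `Ê`-side class of a rational point

HONEST FRAMING: per-curve certified theorems and census instruments; no claim on BSD in rank ≥ 2.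

The composition of the `Ê`-side chain: integral normal form (`exists_ringOfIntegers_descent_value`,
B3b-1) + common-prime control (`common_prime_mem_int`) + support law with norm cut
(`exists_normCut_class`, B3b-2b). For a Vélu three-pair `(E_{m,s}, Ê)` with `m s : ℤ`, `K = ℚ(ζ₃)`,
and a per-row factorisation `2·θ₀·(81s - 12m³) = v · ∏_{q ∈ P} q^{a_q}` over a conjugation-stable family
`P` of pairwise non-associated primes of `𝓞 K` (`θ₀ = 2η + 1`), the `3`-descent value of every rational
point of `Ê` has class `[ζ^j ∏ q^{k_q}]` with `k_q < 3` and the norm cut `k_q + k_{c q} ≡ 0 (mod 3)`.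
Per-row files then only certify `P` (file `Rank2ObservatoryThreeIsoPrimes`) and count classes.

No definitions. References: H. Cohen, *Number Theory I* (GTM 239, 2007), Prop. 8.4.8 (3);
H. Cohen, F. Pazuki, arXiv:0903.4963, Prop. 2.2.
-/

set_option linter.dupNamespace false

noncomputable section

open NumberField WeierstrassCurve

namespace Summit.BirchSwinnertonDyer.BirchSwinnertonDyer.Rank2Observatory.ThreeIso

open Literature.NumberTheory.EllipticCurves Literature.NumberTheory.EllipticCurves.MordellDescent

variable {K : Type*} [Field K] [NumberField K] [IsCyclotomicExtension {3} ℚ K]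

/-- **The `Ê`-side class of a rational point** (B3b-3 = B3b-1 + B3b-2b): with the per-row
factorisation `hfac` of `2θ₀(81s - 12m³)` over the prime family `P`, the descent value of
`Q = (X, Y) ∈ Ê(ℚ)` is `[ζ^j · ∏_{q∈P} q^{k_q}]`, `j, k_q < 3`, `k_q + k_{c q} ≡ 0 (mod 3)`.
[cite: Cohen2007NumberTheoryI, Prop. 8.4.8 (3); CohenPazuki2009, Prop. 2.2] -/
theorem exists_descentEhat_class {ζ : K} (hζ : IsPrimitiveRoot ζ 3) (σ : K ≃ₐ[ℚ] K)
    (hσ : σ ζ = ζ ^ 2) {m s : ℤ} {W W' : WeierstrassCurve ℚ}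
    (h : IsVeluThreePair (m : ℚ) (s : ℚ) W W')
    (P : Finset (𝓞 K)) (hP : ∀ q ∈ P, Prime q)
    (hna : ∀ q ∈ P, ∀ q' ∈ P, Associated q q' → q = q')
    (c : 𝓞 K → 𝓞 K) (hcP : ∀ q ∈ P, c q ∈ P) (hcc : ∀ q ∈ P, c (c q) = q)
    (hcσ : ∀ q ∈ P, Associated (RingOfIntegers.mapRingEquiv (σ : K ≃+* K) q) (c q))
    (v : (𝓞 K)ˣ) (a : 𝓞 K → ℕ)
    (hfac : 2 * (2 * hζ.toInteger + 1) * ((81 * s - 12 * m ^ 3 : ℤ) : 𝓞 K) = v * ∏ q ∈ P, q ^ a q)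
    {X Y : ℚ} (hQ : W'.toAffine.Nonsingular X Y) :
    ∃ (j : ℕ) (k : 𝓞 K → ℕ), j < 3 ∧ (∀ q, k q < 3) ∧ (∀ q ∈ P, (k q + k (c q)) % 3 = 0) ∧
      cubeClass ((Y : K) - (2 * ζ + 1) * (((m : ℚ) : K) * ((X : K) + 4 * ((m : ℚ) : K) ^ 2 / 3)
          + (27 * ((s : ℚ) : K) - 4 * ((m : ℚ) : K) ^ 3) / 9)) =
        cubeClass (ζ ^ j * ∏ q ∈ P, ((q : 𝓞 K) : K) ^ k q) := by
  obtain ⟨n, t, e, θ₀, δ₀, ε₀, _he, hne, hN, hθ₀K, _hθ₀sq, hδ₀, hε₀, hprod, hδ, hε, hclass⟩ :=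
    exists_ringOfIntegers_descent_value hζ h hQ
  have hθ₀₁ : θ₀ = 2 * hζ.toInteger + 1 := by
    apply RingOfIntegers.coe_injective
    change (θ₀ : K) = ((2 * hζ.toInteger + 1 : 𝓞 K) : K)
    rw [hθ₀K, coe_two_mul_toInteger_add_one hζ]
  subst hθ₀₁
  have hcommon : ∀ π : 𝓞 K, Prime π → π ∣ δ₀ → π ∣ ε₀ → ∃ q ∈ P, Associated π q := by
    intro π hπ h₁ h₂
    rw [hδ₀] at h₁
    rw [hε₀] at h₂
    exact common_prime_mem_int hne hN P hP v a hfac π hπ h₁ h₂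
  obtain ⟨j, k, hj, hk, hcut, hcl⟩ := exists_normCut_class hζ σ hσ hθ₀K hδ₀ hε₀ hprod hδ hε P hP
    hna c hcP hcc hcσ hcommon
  exact ⟨j, k, hj, hk, hcut, hclass.trans hcl⟩

end Summit.BirchSwinnertonDyer.BirchSwinnertonDyer.Rank2Observatory.ThreeIso
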